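import Mathlib
import HarnessLib
import Literature.NumberTheory.LFunctions.ZetaScrew
import Literature.Analysis.SpecialFunctions.EulerMascheroniBounds
import Literature.Analysis.ValidatedNumerics.FixedPointInterval
import Literature.Analysis.ValidatedNumerics.TrigLogTables
import Literature.Analysis.ValidatedNumerics.KernelData
import Literature.Analysis.ValidatedNumerics.SymmetricEigenCertificate
import Literature.Analysis.ValidatedNumerics.MatrixEigenEnclosure
import Summits.RiemannHypothesis.RiemannHypothesis.Theorems.IntegerScrewDefs
import Summits.RiemannHypothesis.RiemannHypothesis.Theorems.IntegerScrewNestedSylvester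

/-!
# Route `IntegerScrew` — a kernel certificate checker for the finite rungs `S_M ≻ 0` (1/3: the checker)

The pivot criterion (`IntegerScrewPivotCriterion`: `RH ↔ ∀ M ≥ 2, d_M > 0 ↔ ∀ n, (screwMatrix n).PosDef`)
has RH-free FINITE rungs: each `S_M ≻ 0` is a computation. `IntegerScrewRungThree` did `S_3` by hand; this
file and its two sequels (`…RungCertSeries`, `…RungCertSound`) mechanise the import of the cell's exact
census (HOME/sos, engine A) into the kernel, for any `M ≤ 64` within one `decide +kernel`:

* the entries `G(log a, log b) = Ψ(log a) + Ψ(log b) − Ψ(log(a/b))` of `S_M` (Suzuki2023 (1.1), (1.4)) are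
  ENCLOSED by the tree's kernel-evaluable fixed-point interval engine
  (`Literature.Analysis.ValidatedNumerics.Numerics.FI`, scale `2^48`): `u(a,b) := Ψ(log(a/b)) − C/4 =
  4(√a√b/b + √a√b/a − 2) − Σ_{n ≤ a/b} Λ(n) n^{-1/2}(log a − log b − log n) − (log a − log b)·A/2 −
  (√a√b/a)·Φ(b²/a²)/4` with `A = γ₀ + π/2 + 3 log 2 + log π`, `Φ(x) = Σ_k x^k/(k+¼)²` (geometric partial
  sums + tail `x^K/((K+¼)²(1−x))`), `C = ζ(2,¼)` — logarithms from `FI.logTable`, two-sided `√n`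
  (`sqrtNat`), `Λ(n)` from the table `lamBase` (`n ≤ 64`), `log π = 2 log 2 + log(1 − (1 − π/4))`;
* the RANK-ONE TRICK of `IntegerScrewRungThree`: `S_M = T(C)`, `T(c) := (c/4)(I + J) + U`, and
  `T(C) = T(c_lo) + ((C − c_lo)/4)(I + J) ⪰ T(c_lo)` for the rational lower bound
  `c_lo = Σ_{k<300}(k+¼)^{-2} + 1/(300+¼)` (telescoping), so only a LOWER bound of `ζ(2,¼)` is needed;
* `T(c_lo) ≻ 0` is decided by the tree's generic interval-family certificate checker
  `Literature.Analysis.ValidatedNumerics.checkLower` / `posDef_of_checkLower` (rounded Cholesky factor of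
  the centre minus `λ`, Gershgorin residual with the radii; Rump, Acta Numerica 19 (2010) §10.8) on the
  centre/radius tables read off the enclosures.

THIS FILE: the computable checker `rungCheck N logs utab cert` (all definitions) and the soundness of its
primitives (`mem_sqrtNat`, the logarithm table, the von Mangoldt table `vonMangoldt_eq_log_lamBase`). The
data (`logs`, `utab`) are passed as literals and RE-COMPUTED by the checker (`decide (utab = uTable …)`), as
in `Literature.NumberTheory.LFunctions.ZetaArgumentCertificate`. Certificates are emitted by the cell's
engine-A script (HOME/rh-explicit-sos-eng-1/code/rungcert/mkcert.py: exact re-run of `checkLower` in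
rationals before printing). Nothing here bears on the truth of RH: every rung is an RH-consequence made
unconditional by computation. References: M. Suzuki, J. Lond. Math. Soc. (2) 108 (2023) = arXiv:2206.03682,
(1.1), (1.4) [Suzuki2023]; S. M. Rump, Acta Numerica 19 (2010) 287–449, §10.8 [folklore].
-/

set_option linter.dupNamespace false

namespace Summit.RiemannHypothesis.RiemannHypothesis.Theorems.IntegerScrew.RungCert

open Literature.NumberTheory.LFunctions Literature.Analysis.ValidatedNumerics
open Literature.Analysis.ValidatedNumerics.Numerics Finset
open scoped BigOperators

/-! ## The checker (computable) -/

/-- Table lookup `logs[n]` (junk `ofInt 0` beyond the table). [folklore] -/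
def lg (logs : List FI) (n : ℕ) : FI := logs.getD n (FI.ofInt 0)

/-- Two-sided enclosure of `√n` for a natural number `n` (`n < 2^44`): upper end from the engine's
`natSqrtUp`, lower end `natSqrtUp − 1` validated by squaring (else `0`). [folklore] -/
def sqrtNat (n : ℕ) : FI :=
  let m := n * SC * SC
  let u := natSqrtUp m
  let d := u - 1
  ⟨if d * d ≤ m then (d : ℤ) else 0, (u : ℤ)⟩

/-- The base of the prime power `n ≤ 64` (`Λ(n) = log (lamBase n)`; `1` when `Λ(n) = 0`). [folklore] -/
def lamList : List ℕ :=
  [1, 1, 2, 3, 2, 5, 1, 7, 2, 3, 1, 11, 1, 13, 1, 1, 2, 17, 1, 19, 1, 1, 1, 23, 1, 5, 1, 3, 1, 29,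
   1, 31, 2, 1, 1, 1, 1, 37, 1, 1, 1, 41, 1, 43, 1, 1, 1, 47, 1, 7, 1, 1, 1, 53, 1, 1, 1, 1, 1, 59,
   1, 61, 1, 1, 2]

/-- [folklore] -/
def lamBase (n : ℕ) : ℕ := lamList.getD n 1

/-- One summand `Λ(n) n^{-1/2} (t − log n)` of the prime sum, enclosed (`T ∋ t`). [folklore] -/
def primeTerm (logs : List FI) (T : FI) (n : ℕ) : FI :=
  ((lg logs (lamBase n)).mul ((sqrtNat n).divNat n)).mul (T.sub (lg logs n))

/-- `acc + Σ_{1 ≤ k ≤ n} primeTerm k` by structural recursion. [folklore] -/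
def primeStep (logs : List FI) (T : FI) : ℕ → FI → FI
  | 0, acc => acc
  | n + 1, acc => primeStep logs T n (acc.add (primeTerm logs T (n + 1)))

/-- Enclosure of the prime sum `Σ_{1 ≤ n ≤ m} Λ(n) n^{-1/2}(t − log n)`. [folklore] -/
def primeSumEncl (logs : List FI) (T : FI) (m : ℕ) : FI := primeStep logs T m (FI.ofInt 0)

/-- Scaled tolerance for the Hurwitz–Lerch tail (`2^22 / 2^48 ≈ 1.5e-8`). [folklore] -/
def lerchTol : ℤ := 4194304

/-- Maximal number of Hurwitz–Lerch terms. [folklore] -/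
def lerchFuel : ℕ := 600

/-- Upper bound (as an interval) of the tail `Σ_{j ≥ k} x^j/(j+¼)² ≤ x^k · 16 xd / ((4k+1)² (xd − xn))`,
`x = xn/xd`, given `pw ∋ x^k`. [folklore] -/
def lerchTail (xn xd k : ℕ) (pw : FI) : FI :=
  (pw.mulInt (16 * xd : ℕ)).divNat ((4 * k + 1) ^ 2 * (xd - xn))

/-- The series loop: state `(k, pw ∋ x^k, s ∋ Σ_{j<k} x^j/(j+¼)²)`; stops when the tail bound is below
`lerchTol` or the fuel is exhausted. [folklore] -/
def lerchGo (X : FI) (xn xd : ℕ) : ℕ → ℕ → FI → FI → ℕ × FI × FI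
  | 0, k, pw, s => (k, pw, s)
  | fuel + 1, k, pw, s =>
      if (lerchTail xn xd k pw).hi ≤ lerchTol then (k, pw, s)
      else lerchGo X xn xd fuel (k + 1) (pw.mul X) (s.add ((pw.mulInt 16).divNat ((4 * k + 1) ^ 2)))

/-- Enclosure of `Φ = Σ_k x^k/(k+¼)²` at `x = b²/a²` (`b < a`). [folklore] -/
def lerchEncl (a b : ℕ) : FI :=
  let xn := b * b
  let xd := a * a
  let r := lerchGo (FI.ofFrac xn xd) xn xd lerchFuel 0 (FI.ofInt 1) (FI.ofInt 0)
  r.2.2.add ⟨0, (lerchTail xn xd r.1 r.2.1).hi⟩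

/-- Enclosure of `A = γ₀ + π/2 + 3 log 2 + log π` (`log π = 2 log 2 + log(1 − (1 − π/4))`);
`none` if the engine declines the logarithm. [folklore] -/
def slopeEncl (logs : List FI) : Option FI :=
  match FI.logOneSub ((FI.ofInt 1).sub (FI.pi.divNat 4)) 40 with
  | none => none
  | some l => some ((((FI.ofRatRat (57721558 / 100000000) (57721571 / 100000000)).add
      (FI.pi.divNat 2)).add ((lg logs 2).mulInt 3)).add (((lg logs 2).mulInt 2).add l))

/-- Enclosure of `u(a,b) = Ψ(log(a/b)) − C/4 = 4(s + s' − 2) − P − (t/2)A − s'Φ/4`,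
`s = √(a/b)`, `s' = √(b/a)`, `t = log a − log b` (`1 ≤ b < a`). [folklore] -/
def uEncl (logs : List FI) (A : FI) (a b : ℕ) : FI :=
  let T := (lg logs a).sub (lg logs b)
  let g := (sqrtNat a).mul (sqrtNat b)
  let s := g.divNat b
  let s' := g.divNat a
  let arch := ((s.add s').sub (FI.ofInt 2)).mulInt 4
  let P := primeSumEncl logs T (a / b)
  let lin := (T.mul A).divNat 2
  let ler := (s'.mul (lerchEncl a b)).divNat 4
  ((arch.sub P).sub lin).sub ler

/-- The table `utab[a][b] = uEncl a b` for `b < a ≤ N + 1` (row `a` has `a` entries; entry `b = 0` junk). [folklore] -/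
def uTable (logs : List FI) (A : FI) (N : ℕ) : List (List FI) :=
  (List.range (N + 2)).map fun a => (List.range a).map fun b => uEncl logs A a b

/-- Partial sums `Σ_{k<K} 16/(4k+1)²` of `C = Σ (k+¼)^{-2}`. [folklore] -/
def cPartial : ℕ → FI
  | 0 => FI.ofInt 0
  | K + 1 => (cPartial K).add (FI.ofFrac 16 ((4 * K + 1) ^ 2))

/-- Number of terms for the lower bound of `C`. [folklore] -/
def cTerms : ℕ := 300

/-- A rational lower bound of `C = ζ(2,¼)`: `Σ_{k<K} (k+¼)^{-2} + 1/(K+¼)` rounded down. [folklore] -/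
def cLoQ : ℚ := ((cPartial cTerms).lo : ℚ) / SC + 4 / (4 * cTerms + 1)

/-- Table lookup `utab[a][b]` (junk `ofInt 0` outside). [folklore] -/
def ug (utab : List (List FI)) (a b : ℕ) : FI := (utab.getD a []).getD b (FI.ofInt 0)

/-- Interval of the entry `(i,j)` of `T(c_lo) = (c_lo/4)(I + J) + U` from the table. [folklore] -/
def tEncl (utab : List (List FI)) (i j : ℕ) : FI :=
  if i = j then (FI.ofRatRat (cLoQ / 2) (cLoQ / 2)).add ((ug utab (i + 2) 1).mulInt 2)
  else (((FI.ofRatRat (cLoQ / 4) (cLoQ / 4)).add (ug utab (i + 2) 1)).add (ug utab (j + 2) 1)).sub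
    (ug utab (max i j + 2) (min i j + 2))

/-- Centre of an interval as a rational. [folklore] -/
def midQ (I : FI) : ℚ := ((I.lo + I.hi : ℤ) : ℚ) / (2 * SC)

/-- Radius of an interval as a rational. [folklore] -/
def radQ (I : FI) : ℚ := ((I.hi - I.lo : ℤ) : ℚ) / (2 * SC)

/-- Centre table of `T(c_lo)`. [folklore] -/
def centreTab (utab : List (List FI)) (N : ℕ) : List (List ℚ) := mtab N N fun i j => midQ (tEncl utab i j)

/-- Radius table of `T(c_lo)`. [folklore] -/
def radiusTab (utab : List (List FI)) (N : ℕ) : List (List ℚ) := mtab N N fun i j => radQ (tEncl utab i j)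

/-- **The rung certificate checker** for `S_{N+1} = screwMatrix N ≻ 0`: the supplied logarithm table is
the engine's, the supplied `u`-table is the recomputed one, and the generic interval-family certificate
`checkLower` accepts the centre/radius tables with a positive bound. [folklore] -/
def rungCheck (N : ℕ) (logs : List FI) (utab : List (List FI)) (cert : LDLCert) : Bool :=
  decide (N + 1 ≤ 64) && decide (logs = FI.logTable (N + 1)) && FI.logTableOK (N + 1) &&
    (match slopeEncl logs with
      | none => false
      | some A => decide (utab = uTable logs A N)) &&
    checkLower N (centreTab utab N) (radiusTab utab N) cert && decide (0 < cert.lam)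

/-! ## Soundness of the primitives -/

/-- The engine's logarithm table is valid: `log n ∈ logs[n]` for `n ≤ K`. [folklore] -/
theorem logsOK_of_eq {logs : List FI} {K : ℕ} (h : logs = FI.logTable K) (hok : FI.logTableOK K = true) :
    ∀ n ≤ K, FI.mem (Real.log n) (lg logs n) := fun n hn => by
  rw [lg, h]; exact FI.mem_logTable hok hn

/-- **Two-sided square root.** [folklore] -/
theorem mem_sqrtNat (n : ℕ) : FI.mem (Real.sqrt n) (sqrtNat n) := by
  have hS := SC_pos
  have hsq : Real.sqrt n * SC = Real.sqrt ((n * SC * SC : ℕ) : ℝ) := by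
    push_cast
    rw [show (n : ℝ) * SC * SC = (SC : ℝ) ^ 2 * n by ring, Real.sqrt_mul' _ (Nat.cast_nonneg n),
      Real.sqrt_sq hS.le, mul_comm]
  set m : ℕ := n * SC * SC with hm
  have hum : (m : ℝ) ≤ ((natSqrtUp m : ℕ) : ℝ) ^ 2 := by exact_mod_cast le_natSqrtUp_sq m
  have hhi : Real.sqrt (m : ℝ) ≤ (natSqrtUp m : ℕ) := by
    rw [← Real.sqrt_sq (Nat.cast_nonneg (natSqrtUp m))]
    exact Real.sqrt_le_sqrt hum
  refine ⟨?_, ?_⟩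
  · simp only [sqrtNat]
    rw [hsq]
    split_ifs with hd
    · have hd' : (((natSqrtUp m - 1 : ℕ) : ℝ)) ^ 2 ≤ (m : ℝ) := by exact_mod_cast (sq (natSqrtUp m - 1)) ▸ hd
      have h0 : (0 : ℝ) ≤ ((natSqrtUp m - 1 : ℕ) : ℝ) := Nat.cast_nonneg _
      have := Real.sqrt_le_sqrt hd'
      rw [Real.sqrt_sq h0] at this
      push_cast [Int.cast_natCast] at this ⊢
      exact this
    · push_cast; exact Real.sqrt_nonneg _
  · simp only [sqrtNat]
    rw [hsq]; push_cast [Int.cast_natCast]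
    exact hhi

/-- `lamBase n ≤ 64` for `n ≤ 64` (so that the table of logarithms covers it). [folklore] -/
theorem lamBase_le {n : ℕ} (hn : n ≤ 64) : lamBase n ≤ max n 1 := by
  interval_cases n <;> decide

/-- A natural number with two distinct prime divisors is not a prime power. [folklore] -/
theorem not_isPrimePow_of_two_primes {n p q : ℕ} (hp : p.Prime) (hq : q.Prime) (hpq : p ≠ q)
    (hpn : p ∣ n) (hqn : q ∣ n) : ¬IsPrimePow n := by
  intro h
  obtain ⟨r, -, hr⟩ := (isPrimePow_iff_unique_prime_dvd.1 h)
  exact hpq ((hr p ⟨hp, hpn⟩).trans (hr q ⟨hq, hqn⟩).symm)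

/-- **The von Mangoldt table**: `Λ(n) = log (lamBase n)` for `n ≤ 64`. [folklore] -/
theorem vonMangoldt_eq_log_lamBase {n : ℕ} (hn : n ≤ 64) :
    (ArithmeticFunction.vonMangoldt n : ℝ) = Real.log (lamBase n) := by
  interval_cases n
  · rw [show lamBase 0 = 1 from rfl, ArithmeticFunction.map_zero]; simp
  · rw [show lamBase 1 = 1 from rfl, ArithmeticFunction.vonMangoldt_apply_one]; simp
  · rw [show lamBase 2 = 2 from rfl, ArithmeticFunction.vonMangoldt_apply_prime (by norm_num)]
  · rw [show lamBase 3 = 3 from rfl, ArithmeticFunction.vonMangoldt_apply_prime (by norm_num)]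
  · rw [show lamBase 4 = 2 from rfl, show (4 : ℕ) = 2 ^ 2 from rfl,
      ArithmeticFunction.vonMangoldt_apply_pow (by norm_num), ArithmeticFunction.vonMangoldt_apply_prime (by norm_num)]
  · rw [show lamBase 5 = 5 from rfl, ArithmeticFunction.vonMangoldt_apply_prime (by norm_num)]
  · rw [show lamBase 6 = 1 from rfl, ArithmeticFunction.vonMangoldt_eq_zero_iff.2
      (not_isPrimePow_of_two_primes (p := 2) (q := 3) (by norm_num) (by norm_num) (by norm_num) (by norm_num) (by norm_num))]
    simp
  · rw [show lamBase 7 = 7 from rfl, ArithmeticFunction.vonMangoldt_apply_prime (by norm_num)]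
  · rw [show lamBase 8 = 2 from rfl, show (8 : ℕ) = 2 ^ 3 from rfl,
      ArithmeticFunction.vonMangoldt_apply_pow (by norm_num), ArithmeticFunction.vonMangoldt_apply_prime (by norm_num)]
  · rw [show lamBase 9 = 3 from rfl, show (9 : ℕ) = 3 ^ 2 from rfl,
      ArithmeticFunction.vonMangoldt_apply_pow (by norm_num), ArithmeticFunction.vonMangoldt_apply_prime (by norm_num)]
  · rw [show lamBase 10 = 1 from rfl, ArithmeticFunction.vonMangoldt_eq_zero_iff.2
      (not_isPrimePow_of_two_primes (p := 2) (q := 5) (by norm_num) (by norm_num) (by norm_num) (by norm_num) (by norm_num))]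
    simp
  · rw [show lamBase 11 = 11 from rfl, ArithmeticFunction.vonMangoldt_apply_prime (by norm_num)]
  · rw [show lamBase 12 = 1 from rfl, ArithmeticFunction.vonMangoldt_eq_zero_iff.2
      (not_isPrimePow_of_two_primes (p := 2) (q := 3) (by norm_num) (by norm_num) (by norm_num) (by norm_num) (by norm_num))]
    simp
  · rw [show lamBase 13 = 13 from rfl, ArithmeticFunction.vonMangoldt_apply_prime (by norm_num)]
  · rw [show lamBase 14 = 1 from rfl, ArithmeticFunction.vonMangoldt_eq_zero_iff.2
      (not_isPrimePow_of_two_primes (p := 2) (q := 7) (by norm_num) (by norm_num) (by norm_num) (by norm_num) (by norm_num))]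
    simp
  · rw [show lamBase 15 = 1 from rfl, ArithmeticFunction.vonMangoldt_eq_zero_iff.2
      (not_isPrimePow_of_two_primes (p := 3) (q := 5) (by norm_num) (by norm_num) (by norm_num) (by norm_num) (by norm_num))]
    simp
  · rw [show lamBase 16 = 2 from rfl, show (16 : ℕ) = 2 ^ 4 from rfl,
      ArithmeticFunction.vonMangoldt_apply_pow (by norm_num), ArithmeticFunction.vonMangoldt_apply_prime (by norm_num)]
  · rw [show lamBase 17 = 17 from rfl, ArithmeticFunction.vonMangoldt_apply_prime (by norm_num)]
  · rw [show lamBase 18 = 1 from rfl, ArithmeticFunction.vonMangoldt_eq_zero_iff.2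
      (not_isPrimePow_of_two_primes (p := 2) (q := 3) (by norm_num) (by norm_num) (by norm_num) (by norm_num) (by norm_num))]
    simp
  · rw [show lamBase 19 = 19 from rfl, ArithmeticFunction.vonMangoldt_apply_prime (by norm_num)]
  · rw [show lamBase 20 = 1 from rfl, ArithmeticFunction.vonMangoldt_eq_zero_iff.2
      (not_isPrimePow_of_two_primes (p := 2) (q := 5) (by norm_num) (by norm_num) (by norm_num) (by norm_num) (by norm_num))]
    simp
  · rw [show lamBase 21 = 1 from rfl, ArithmeticFunction.vonMangoldt_eq_zero_iff.2
      (not_isPrimePow_of_two_primes (p := 3) (q := 7) (by norm_num) (by norm_num) (by norm_num) (by norm_num) (by norm_num))]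
    simp
  · rw [show lamBase 22 = 1 from rfl, ArithmeticFunction.vonMangoldt_eq_zero_iff.2
      (not_isPrimePow_of_two_primes (p := 2) (q := 11) (by norm_num) (by norm_num) (by norm_num) (by norm_num) (by norm_num))]
    simp
  · rw [show lamBase 23 = 23 from rfl, ArithmeticFunction.vonMangoldt_apply_prime (by norm_num)]
  · rw [show lamBase 24 = 1 from rfl, ArithmeticFunction.vonMangoldt_eq_zero_iff.2
      (not_isPrimePow_of_two_primes (p := 2) (q := 3) (by norm_num) (by norm_num) (by norm_num) (by norm_num) (by norm_num))]
    simp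
  · rw [show lamBase 25 = 5 from rfl, show (25 : ℕ) = 5 ^ 2 from rfl,
      ArithmeticFunction.vonMangoldt_apply_pow (by norm_num), ArithmeticFunction.vonMangoldt_apply_prime (by norm_num)]
  · rw [show lamBase 26 = 1 from rfl, ArithmeticFunction.vonMangoldt_eq_zero_iff.2
      (not_isPrimePow_of_two_primes (p := 2) (q := 13) (by norm_num) (by norm_num) (by norm_num) (by norm_num) (by norm_num))]
    simp
  · rw [show lamBase 27 = 3 from rfl, show (27 : ℕ) = 3 ^ 3 from rfl,
      ArithmeticFunction.vonMangoldt_apply_pow (by norm_num), ArithmeticFunction.vonMangoldt_apply_prime (by norm_num)]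
  · rw [show lamBase 28 = 1 from rfl, ArithmeticFunction.vonMangoldt_eq_zero_iff.2
      (not_isPrimePow_of_two_primes (p := 2) (q := 7) (by norm_num) (by norm_num) (by norm_num) (by norm_num) (by norm_num))]
    simp
  · rw [show lamBase 29 = 29 from rfl, ArithmeticFunction.vonMangoldt_apply_prime (by norm_num)]
  · rw [show lamBase 30 = 1 from rfl, ArithmeticFunction.vonMangoldt_eq_zero_iff.2
      (not_isPrimePow_of_two_primes (p := 2) (q := 3) (by norm_num) (by norm_num) (by norm_num) (by norm_num) (by norm_num))]
    simp
  · rw [show lamBase 31 = 31 from rfl, ArithmeticFunction.vonMangoldt_apply_prime (by norm_num)]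
  · rw [show lamBase 32 = 2 from rfl, show (32 : ℕ) = 2 ^ 5 from rfl,
      ArithmeticFunction.vonMangoldt_apply_pow (by norm_num), ArithmeticFunction.vonMangoldt_apply_prime (by norm_num)]
  · rw [show lamBase 33 = 1 from rfl, ArithmeticFunction.vonMangoldt_eq_zero_iff.2
      (not_isPrimePow_of_two_primes (p := 3) (q := 11) (by norm_num) (by norm_num) (by norm_num) (by norm_num) (by norm_num))]
    simp
  · rw [show lamBase 34 = 1 from rfl, ArithmeticFunction.vonMangoldt_eq_zero_iff.2
      (not_isPrimePow_of_two_primes (p := 2) (q := 17) (by norm_num) (by norm_num) (by norm_num) (by norm_num) (by norm_num))]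
    simp
  · rw [show lamBase 35 = 1 from rfl, ArithmeticFunction.vonMangoldt_eq_zero_iff.2
      (not_isPrimePow_of_two_primes (p := 5) (q := 7) (by norm_num) (by norm_num) (by norm_num) (by norm_num) (by norm_num))]
    simp
  · rw [show lamBase 36 = 1 from rfl, ArithmeticFunction.vonMangoldt_eq_zero_iff.2
      (not_isPrimePow_of_two_primes (p := 2) (q := 3) (by norm_num) (by norm_num) (by norm_num) (by norm_num) (by norm_num))]
    simp
  · rw [show lamBase 37 = 37 from rfl, ArithmeticFunction.vonMangoldt_apply_prime (by norm_num)]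
  · rw [show lamBase 38 = 1 from rfl, ArithmeticFunction.vonMangoldt_eq_zero_iff.2
      (not_isPrimePow_of_two_primes (p := 2) (q := 19) (by norm_num) (by norm_num) (by norm_num) (by norm_num) (by norm_num))]
    simp
  · rw [show lamBase 39 = 1 from rfl, ArithmeticFunction.vonMangoldt_eq_zero_iff.2
      (not_isPrimePow_of_two_primes (p := 3) (q := 13) (by norm_num) (by norm_num) (by norm_num) (by norm_num) (by norm_num))]
    simp
  · rw [show lamBase 40 = 1 from rfl, ArithmeticFunction.vonMangoldt_eq_zero_iff.2
      (not_isPrimePow_of_two_primes (p := 2) (q := 5) (by norm_num) (by norm_num) (by norm_num) (by norm_num) (by norm_num))]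
    simp
  · rw [show lamBase 41 = 41 from rfl, ArithmeticFunction.vonMangoldt_apply_prime (by norm_num)]
  · rw [show lamBase 42 = 1 from rfl, ArithmeticFunction.vonMangoldt_eq_zero_iff.2
      (not_isPrimePow_of_two_primes (p := 2) (q := 3) (by norm_num) (by norm_num) (by norm_num) (by norm_num) (by norm_num))]
    simp
  · rw [show lamBase 43 = 43 from rfl, ArithmeticFunction.vonMangoldt_apply_prime (by norm_num)]
  · rw [show lamBase 44 = 1 from rfl, ArithmeticFunction.vonMangoldt_eq_zero_iff.2
      (not_isPrimePow_of_two_primes (p := 2) (q := 11) (by norm_num) (by norm_num) (by norm_num) (by norm_num) (by norm_num))]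
    simp
  · rw [show lamBase 45 = 1 from rfl, ArithmeticFunction.vonMangoldt_eq_zero_iff.2
      (not_isPrimePow_of_two_primes (p := 3) (q := 5) (by norm_num) (by norm_num) (by norm_num) (by norm_num) (by norm_num))]
    simp
  · rw [show lamBase 46 = 1 from rfl, ArithmeticFunction.vonMangoldt_eq_zero_iff.2
      (not_isPrimePow_of_two_primes (p := 2) (q := 23) (by norm_num) (by norm_num) (by norm_num) (by norm_num) (by norm_num))]
    simp
  · rw [show lamBase 47 = 47 from rfl, ArithmeticFunction.vonMangoldt_apply_prime (by norm_num)]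
  · rw [show lamBase 48 = 1 from rfl, ArithmeticFunction.vonMangoldt_eq_zero_iff.2
      (not_isPrimePow_of_two_primes (p := 2) (q := 3) (by norm_num) (by norm_num) (by norm_num) (by norm_num) (by norm_num))]
    simp
  · rw [show lamBase 49 = 7 from rfl, show (49 : ℕ) = 7 ^ 2 from rfl,
      ArithmeticFunction.vonMangoldt_apply_pow (by norm_num), ArithmeticFunction.vonMangoldt_apply_prime (by norm_num)]
  · rw [show lamBase 50 = 1 from rfl, ArithmeticFunction.vonMangoldt_eq_zero_iff.2
      (not_isPrimePow_of_two_primes (p := 2) (q := 5) (by norm_num) (by norm_num) (by norm_num) (by norm_num) (by norm_num))]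
    simp
  · rw [show lamBase 51 = 1 from rfl, ArithmeticFunction.vonMangoldt_eq_zero_iff.2
      (not_isPrimePow_of_two_primes (p := 3) (q := 17) (by norm_num) (by norm_num) (by norm_num) (by norm_num) (by norm_num))]
    simp
  · rw [show lamBase 52 = 1 from rfl, ArithmeticFunction.vonMangoldt_eq_zero_iff.2
      (not_isPrimePow_of_two_primes (p := 2) (q := 13) (by norm_num) (by norm_num) (by norm_num) (by norm_num) (by norm_num))]
    simp
  · rw [show lamBase 53 = 53 from rfl, ArithmeticFunction.vonMangoldt_apply_prime (by norm_num)]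
  · rw [show lamBase 54 = 1 from rfl, ArithmeticFunction.vonMangoldt_eq_zero_iff.2
      (not_isPrimePow_of_two_primes (p := 2) (q := 3) (by norm_num) (by norm_num) (by norm_num) (by norm_num) (by norm_num))]
    simp
  · rw [show lamBase 55 = 1 from rfl, ArithmeticFunction.vonMangoldt_eq_zero_iff.2
      (not_isPrimePow_of_two_primes (p := 5) (q := 11) (by norm_num) (by norm_num) (by norm_num) (by norm_num) (by norm_num))]
    simp
  · rw [show lamBase 56 = 1 from rfl, ArithmeticFunction.vonMangoldt_eq_zero_iff.2
      (not_isPrimePow_of_two_primes (p := 2) (q := 7) (by norm_num) (by norm_num) (by norm_num) (by norm_num) (by norm_num))]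
    simp
  · rw [show lamBase 57 = 1 from rfl, ArithmeticFunction.vonMangoldt_eq_zero_iff.2
      (not_isPrimePow_of_two_primes (p := 3) (q := 19) (by norm_num) (by norm_num) (by norm_num) (by norm_num) (by norm_num))]
    simp
  · rw [show lamBase 58 = 1 from rfl, ArithmeticFunction.vonMangoldt_eq_zero_iff.2
      (not_isPrimePow_of_two_primes (p := 2) (q := 29) (by norm_num) (by norm_num) (by norm_num) (by norm_num) (by norm_num))]
    simp
  · rw [show lamBase 59 = 59 from rfl, ArithmeticFunction.vonMangoldt_apply_prime (by norm_num)]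
  · rw [show lamBase 60 = 1 from rfl, ArithmeticFunction.vonMangoldt_eq_zero_iff.2
      (not_isPrimePow_of_two_primes (p := 2) (q := 3) (by norm_num) (by norm_num) (by norm_num) (by norm_num) (by norm_num))]
    simp
  · rw [show lamBase 61 = 61 from rfl, ArithmeticFunction.vonMangoldt_apply_prime (by norm_num)]
  · rw [show lamBase 62 = 1 from rfl, ArithmeticFunction.vonMangoldt_eq_zero_iff.2
      (not_isPrimePow_of_two_primes (p := 2) (q := 31) (by norm_num) (by norm_num) (by norm_num) (by norm_num) (by norm_num))]
    simp
  · rw [show lamBase 63 = 1 from rfl, ArithmeticFunction.vonMangoldt_eq_zero_iff.2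
      (not_isPrimePow_of_two_primes (p := 3) (q := 7) (by norm_num) (by norm_num) (by norm_num) (by norm_num) (by norm_num))]
    simp
  · rw [show lamBase 64 = 2 from rfl, show (64 : ℕ) = 2 ^ 6 from rfl,
      ArithmeticFunction.vonMangoldt_apply_pow (by norm_num), ArithmeticFunction.vonMangoldt_apply_prime (by norm_num)]

/-- The von Mangoldt base is a positive natural number for `n ≤ 64` (so `Real.log (lamBase n)` is the
logarithm of a positive integer; `lamBase n = 1` exactly when `Λ(n) = 0`). [folklore] -/
theorem lamBase_pos {n : ℕ} (hn : n ≤ 64) : 0 < lamBase n := by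
  interval_cases n <;> decide

end Summit.RiemannHypothesis.RiemannHypothesis.Theorems.IntegerScrew.RungCert
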